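import Summits.BirchSwinnertonDyer.BirchSwinnertonDyer.Theorems.ResidualThetaTransportAtTwoThetaLayerLambdaCongruenceAtTwoCurveMuPropagation
import HarnessLib

/-!
# Crux `ThetaLayerLambdaCongruenceAtTwo` (stmt-BirchSwinnertonDyer-20688, route ResidualThetaTransportAtTwo), line `birth`:
# the curve's depleted plus symbol is NON-ZERO and PRIMITIVELY SCALABLE for EVERY elliptic curve (no `L(W,1) ≠ 0`), hence
# analytic `μ`-propagation from congruent curves `A` of ANY rank

Width seat bsd-wall-rtt-p3-w2 g2 (`--supports stmt-BirchSwinnertonDyer-20688`; closes nothing). THEOREMS ONLY — no definition, no named fact,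
no `sorry`; Deligne's named fact and (C3⁺) are hypotheses; nothing about any curve or form is asserted; BSD is not proved by any of this.

WHAT. The propagation theorem `curveDepletedSymbolMax_of_congruent_of_plusLine` (p612136) asks `analyticRank A = 0` of the congruent
curve `A` only because w2 g0's `exists_primitive_scaling_depletedCurveSymbol` proves the non-vanishing of the depleted symbol at `r = 0`
from `L(A,1) ≠ 0`. Here:
* §1 `exists_depletedCurveSymbol_ne_zero` — for EVERY globally minimal elliptic `W/ℚ` with newform `f` and every finite set `S₀` of
  places, the `S₀`-depleted rational plus symbol `φ^{S₀}_W` is NOT identically zero: w3 g2's injectivity of depletion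
  (`exists_depletedPartnerSymbol_ne_zero_of_nonRoot`, `…DepletionInjective`) applied to the newform `f` itself through w2 g0's embedding
  `exists_embedding_of_isNewformOf` (`ι[x]⁺_{f,Ω⁺_f} = [x]⁺_f`, `embCoeff f ι = a_·(W)`) and `map_localPolynomialAt_eq`
  (`L_v(W,X) = 1 − a_ℓ X + 𝟙_{ℓ∤N}ℓX²`); the non-root input is Deligne's fact at `ℓ ∤ N_W` and the Atkin–Lehner bound at `ℓ ∣ N_W`
  (`eval_partnerEulerPolynomial_ne_zero_of_deligne` / `_of_levelCoeffBound`).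
* §2 `exists_primitive_scaling_depletedCurveSymbol_of_deligne` — w2 g0's primitive scaling with §1 as the non-vanishing input.
* §3 `curveDepletedSymbolMax_of_congruent_of_plusLine_of_deligne` / `…_of_congruent_of_deligne` / `…_of_plusSymbolMax_of_deligne` —
  propagation (μ-W₁)(A,S₀) ⟹ (μ-W₁)(W,S₀) and (μ-W₀)(A) ⟹ (μ-W₁)(W,S₀) for congruent `A` of ANY analytic rank (e.g. the rational CM
  partner curve on the theta habitat, whatever its rank; or any member of the mod-`2` class).

References: [GreenbergVatsal2000] Thm. (1.4), §1 (8)–(10); [Deligne1974] Thm. (8.2); [AtkinLehner1970] Thm. 3; [Manin1972] Cor. 3.6.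
-/

set_option autoImplicit false
-- justification: the `Summit.BirchSwinnertonDyer.BirchSwinnertonDyer.…` path repeats a component (route-file convention)
set_option linter.dupNamespace false

noncomputable section

open scoped Classical MatrixGroups Polynomial

open Polynomial CongruenceSubgroup Literature.NumberTheory.EllipticCurves Literature.NumberTheory.EllipticCurves.ModularForms

namespace Summit.BirchSwinnertonDyer.BirchSwinnertonDyer.Theorems.ThetaLayerLambdaCongruenceAtTwo

/-! ## §1. The curve's depleted plus symbol is not identically zero (any rank) -/

section NonZero

variable {W : WeierstrassCurve ℚ} {f : CuspForm (CongruenceSubgroup.Gamma0 (W.conductorNorm ℤ)) 2}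

/-- **`φ^{S₀}_W ≢ 0` for every elliptic curve.** For a globally minimal elliptic `W/ℚ`, its newform `f` and ANY finite set `S₀` of
places, some value of the `S₀`-depleted rational plus symbol is non-zero — injectivity of depletion (`…DepletionInjective`) for the
form `f` read through the embedding `ι : K_f = ℚ → ℚ̄₂` of `exists_embedding_of_isNewformOf`; non-root of the Euler factors from
Deligne's fact (`ℓ ∤ N_W`) and the Atkin–Lehner level bound (`ℓ ∣ N_W`). [cite: GreenbergVatsal2000, §1 (8)] [cite: Deligne1974, Thm. (8.2)]
[cite: AtkinLehner1970, Thm. 3] -/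
theorem exists_depletedCurveSymbol_ne_zero [W.IsElliptic] [W.IsGloballyMinimal] [NeZero (W.conductorNorm ℤ)]
    (hD : Deligne1974_heckeT_eigenvalue_norm_le) (hf : IsNewformOf W f)
    (S₀ : Finset (IsDedekindDomain.HeightOneSpectrum (NumberField.RingOfIntegers ℚ))) :
    ∃ r : ℚ, (∑ k ∈ Fintype.piFinset (fun _ : S₀ ↦ Finset.range 3), (∏ v : S₀, ((W.localPolynomialAt (v : IsDedekindDomain.HeightOneSpectrum (NumberField.RingOfIntegers ℚ))).map (Int.castRingHom (PadicAlgCl 2))).coeff (k v) * ((Rat.HeightOneSpectrum.natGenerator (v : IsDedekindDomain.HeightOneSpectrum (NumberField.RingOfIntegers ℚ)) : PadicAlgCl 2)⁻¹) ^ (k v)) * algebraMap ℚ (PadicAlgCl 2) (ratPlusSymbol f (r * ((∏ v : S₀, Rat.HeightOneSpectrum.natGenerator (v : IsDedekindDomain.HeightOneSpectrum (NumberField.RingOfIntegers ℚ)) ^ (k v) : ℕ) : ℚ)))) ≠ 0 := by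
  obtain ⟨ι, hι, hιa⟩ := exists_embedding_of_isNewformOf hf
  have hΩ : IsPlusPeriod f (plusPeriod f : ℂ) := isPlusPeriod_plusPeriod hf.1 hf.coeffField_eq_bot
  obtain ⟨r, hr⟩ := exists_depletedPartnerSymbol_ne_zero_of_nonRoot ι (plusPeriod f : ℂ) S₀ hf.1 hΩ (fun v _ ζ hζ ↦ by
    by_cases hℓM : Rat.HeightOneSpectrum.natGenerator v ∣ W.conductorNorm ℤ
    · exact eval_partnerEulerPolynomial_ne_zero_of_levelCoeffBound ι (Rat.HeightOneSpectrum.prime_natGenerator v) hℓM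
        (norm_cuspCoeff_le_one_of_dvd_level hf.1 (Rat.HeightOneSpectrum.prime_natGenerator v) hℓM) ζ hζ
    · exact eval_partnerEulerPolynomial_ne_zero_of_deligne ι hD hf.1 (Rat.HeightOneSpectrum.prime_natGenerator v) hℓM ζ hζ)
  refine ⟨r, fun h0 ↦ hr ?_⟩
  rw [← h0]
  refine Finset.sum_congr rfl fun k _ ↦ ?_
  rw [hι]
  congr 1
  refine Finset.prod_congr rfl fun v _ ↦ ?_
  rw [map_localPolynomialAt_eq W, hιa]

end NonZero

/-! ## §2. Primitive scaling without `L(W,1) ≠ 0` -/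

section Primitive

variable {W : WeierstrassCurve ℚ} {f : CuspForm (CongruenceSubgroup.Gamma0 (W.conductorNorm ℤ)) 2}

/-- **Primitive `2`-adic scaling of the curve's depleted plus symbol WITHOUT `L(W,1) ≠ 0`** (w2 g0's
`exists_primitive_scaling_depletedCurveSymbol` with the non-vanishing input taken from §1 — Deligne's fact + Atkin–Lehner at the
level instead of the analytic rank): `∃ c, ‖c·φ^{S₀}_W‖ ≤ 1` everywhere and `= 1` somewhere. Bounded denominators by Manin–Drinfeld
exactly as there. [cite: Manin1972, Cor. 3.6] [cite: Deligne1974, Thm. (8.2)] -/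
theorem exists_primitive_scaling_depletedCurveSymbol_of_deligne [W.IsElliptic] [W.IsGloballyMinimal] [NeZero (W.conductorNorm ℤ)]
    (hDel : Deligne1974_heckeT_eigenvalue_norm_le) (hf : IsNewformOf W f)
    (S₀ : Finset (IsDedekindDomain.HeightOneSpectrum (NumberField.RingOfIntegers ℚ))) :
    ∃ c : PadicAlgCl 2,
      (∀ x : ℚ, ‖c * (∑ k ∈ Fintype.piFinset (fun _ : S₀ ↦ Finset.range 3),
        (∏ v : S₀, ((W.localPolynomialAt (v : IsDedekindDomain.HeightOneSpectrum (NumberField.RingOfIntegers ℚ))).map (Int.castRingHom (PadicAlgCl 2))).coeff (k v) *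
            ((Rat.HeightOneSpectrum.natGenerator (v : IsDedekindDomain.HeightOneSpectrum (NumberField.RingOfIntegers ℚ)) : PadicAlgCl 2)⁻¹) ^ (k v)) *
          algebraMap ℚ (PadicAlgCl 2) (ratPlusSymbol f (x * ((∏ v : S₀, Rat.HeightOneSpectrum.natGenerator (v : IsDedekindDomain.HeightOneSpectrum (NumberField.RingOfIntegers ℚ)) ^ (k v) : ℕ) : ℚ))))‖ ≤ 1) ∧
      ∃ x : ℚ, ‖c * (∑ k ∈ Fintype.piFinset (fun _ : S₀ ↦ Finset.range 3),
        (∏ v : S₀, ((W.localPolynomialAt (v : IsDedekindDomain.HeightOneSpectrum (NumberField.RingOfIntegers ℚ))).map (Int.castRingHom (PadicAlgCl 2))).coeff (k v) *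
            ((Rat.HeightOneSpectrum.natGenerator (v : IsDedekindDomain.HeightOneSpectrum (NumberField.RingOfIntegers ℚ)) : PadicAlgCl 2)⁻¹) ^ (k v)) *
          algebraMap ℚ (PadicAlgCl 2) (ratPlusSymbol f (x * ((∏ v : S₀, Rat.HeightOneSpectrum.natGenerator (v : IsDedekindDomain.HeightOneSpectrum (NumberField.RingOfIntegers ℚ)) ^ (k v) : ℕ) : ℚ))))‖ = 1 := by
  -- common denominator of the rational plus symbols (Manin–Drinfeld)
  obtain ⟨D, hDpos, hD⟩ := exists_forall_ratPlusSymbol_eq_div_of_maninDrinfeld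
    (exists_nsmul_modularSymbol_mem_periodLattice_holds f)
  -- numerators `Z x` with `ρ x · B = Z x`
  choose Z hZ using fun x ↦ exists_int_depletedCurveSymbolRat (W := W) (f := f) S₀ hDpos hD x
  set B : ℕ := D * (∏ v : S₀, Rat.HeightOneSpectrum.natGenerator
    (v : IsDedekindDomain.HeightOneSpectrum (NumberField.RingOfIntegers ℚ))) ^ 2 with hBdef
  have hBpos : 0 < B := Nat.mul_pos hDpos (pow_pos (Finset.prod_pos fun v _ ↦
    (Rat.HeightOneSpectrum.prime_natGenerator _).pos) 2)
  have hB0 : (B : ℚ) ≠ 0 := by exact_mod_cast hBpos.ne'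
  have hBK : ‖(B : PadicAlgCl 2)‖ ≠ 0 := norm_ne_zero_iff.mpr (by exact_mod_cast hBpos.ne')
  -- the symbol at `x` is `algebraMap (Z x / B)`
  have hval : ∀ x : ℚ, (∑ k ∈ Fintype.piFinset (fun _ : S₀ ↦ Finset.range 3),
        (∏ v : S₀, ((W.localPolynomialAt (v : IsDedekindDomain.HeightOneSpectrum (NumberField.RingOfIntegers ℚ))).map (Int.castRingHom (PadicAlgCl 2))).coeff (k v) *
            ((Rat.HeightOneSpectrum.natGenerator (v : IsDedekindDomain.HeightOneSpectrum (NumberField.RingOfIntegers ℚ)) : PadicAlgCl 2)⁻¹) ^ (k v)) *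
          algebraMap ℚ (PadicAlgCl 2) (ratPlusSymbol f (x * ((∏ v : S₀, Rat.HeightOneSpectrum.natGenerator (v : IsDedekindDomain.HeightOneSpectrum (NumberField.RingOfIntegers ℚ)) ^ (k v) : ℕ) : ℚ)))) = algebraMap ℚ (PadicAlgCl 2) ((Z x : ℚ) / B) := by
    intro x
    rw [depletedCurveSymbol_eq_algebraMap]
    congr 1
    rw [eq_div_iff hB0]
    exact hZ x
  have hnorm : ∀ x : ℚ, ‖(∑ k ∈ Fintype.piFinset (fun _ : S₀ ↦ Finset.range 3),
        (∏ v : S₀, ((W.localPolynomialAt (v : IsDedekindDomain.HeightOneSpectrum (NumberField.RingOfIntegers ℚ))).map (Int.castRingHom (PadicAlgCl 2))).coeff (k v) *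
            ((Rat.HeightOneSpectrum.natGenerator (v : IsDedekindDomain.HeightOneSpectrum (NumberField.RingOfIntegers ℚ)) : PadicAlgCl 2)⁻¹) ^ (k v)) *
          algebraMap ℚ (PadicAlgCl 2) (ratPlusSymbol f (x * ((∏ v : S₀, Rat.HeightOneSpectrum.natGenerator (v : IsDedekindDomain.HeightOneSpectrum (NumberField.RingOfIntegers ℚ)) ^ (k v) : ℕ) : ℚ))))‖ = ‖(Z x : PadicAlgCl 2)‖ / ‖(B : PadicAlgCl 2)‖ := by
    intro x
    rw [hval x, map_div₀, map_intCast, map_natCast, norm_div]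
  -- non-vanishing SOMEWHERE (no `L(W,1) ≠ 0` needed): the depleted symbol is not identically zero (§1)
  obtain ⟨x₁, hx₁⟩ := exists_depletedCurveSymbol_ne_zero hDel hf S₀
  have hZ1 : Z x₁ ≠ 0 := by
    intro h0
    apply hx₁
    rw [hval x₁, h0, Int.cast_zero, zero_div, map_zero]
  -- the least `2`-adic valuation of a non-zero numerator
  have hP : ∃ n : ℕ, ∃ x : ℚ, Z x ≠ 0 ∧ padicValInt 2 (Z x) = n := ⟨_, x₁, hZ1, rfl⟩
  obtain ⟨x₀, hx₀, hn₀⟩ := Nat.find_spec hP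
  have hmin : ∀ x : ℚ, Z x ≠ 0 → padicValInt 2 (Z x₀) ≤ padicValInt 2 (Z x) := fun x hx ↦ by
    rw [hn₀]; exact Nat.find_min' hP ⟨x, hx, rfl⟩
  have hZx₀ : ‖(Z x₀ : PadicAlgCl 2)‖ ≠ 0 := norm_ne_zero_iff.mpr (by exact_mod_cast hx₀)
  have hΦ0 : (∑ k ∈ Fintype.piFinset (fun _ : S₀ ↦ Finset.range 3),
        (∏ v : S₀, ((W.localPolynomialAt (v : IsDedekindDomain.HeightOneSpectrum (NumberField.RingOfIntegers ℚ))).map (Int.castRingHom (PadicAlgCl 2))).coeff (k v) *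
            ((Rat.HeightOneSpectrum.natGenerator (v : IsDedekindDomain.HeightOneSpectrum (NumberField.RingOfIntegers ℚ)) : PadicAlgCl 2)⁻¹) ^ (k v)) *
          algebraMap ℚ (PadicAlgCl 2) (ratPlusSymbol f (x₀ * ((∏ v : S₀, Rat.HeightOneSpectrum.natGenerator (v : IsDedekindDomain.HeightOneSpectrum (NumberField.RingOfIntegers ℚ)) ^ (k v) : ℕ) : ℚ)))) ≠ 0 := by
    rw [← norm_ne_zero_iff, hnorm]
    exact div_ne_zero hZx₀ hBK
  refine ⟨((∑ k ∈ Fintype.piFinset (fun _ : S₀ ↦ Finset.range 3),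
        (∏ v : S₀, ((W.localPolynomialAt (v : IsDedekindDomain.HeightOneSpectrum (NumberField.RingOfIntegers ℚ))).map (Int.castRingHom (PadicAlgCl 2))).coeff (k v) *
            ((Rat.HeightOneSpectrum.natGenerator (v : IsDedekindDomain.HeightOneSpectrum (NumberField.RingOfIntegers ℚ)) : PadicAlgCl 2)⁻¹) ^ (k v)) *
          algebraMap ℚ (PadicAlgCl 2) (ratPlusSymbol f (x₀ * ((∏ v : S₀, Rat.HeightOneSpectrum.natGenerator (v : IsDedekindDomain.HeightOneSpectrum (NumberField.RingOfIntegers ℚ)) ^ (k v) : ℕ) : ℚ)))))⁻¹, fun x ↦ ?_, x₀, by rw [inv_mul_cancel₀ hΦ0, norm_one]⟩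
  rw [norm_mul, norm_inv, hnorm x, hnorm x₀]
  by_cases hx : Z x = 0
  · rw [hx, Int.cast_zero, norm_zero, zero_div, mul_zero]; exact zero_le_one
  · rw [inv_div, div_mul_div_comm, mul_comm ‖(B : PadicAlgCl 2)‖, mul_div_mul_right _ _ hBK,
      div_le_one (lt_of_le_of_ne (norm_nonneg _) hZx₀.symm), norm_intCast_padicAlgCl_two_eq_zpow hx,
      norm_intCast_padicAlgCl_two_eq_zpow hx₀]
    exact zpow_le_zpow_right₀ (by norm_num) (neg_le_neg (Int.ofNat_le.mpr (hmin x hx)))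

end Primitive

/-! ## §3. Propagation from congruent curves of any rank -/

section Propagation

variable {W : WeierstrassCurve ℚ} [W.IsElliptic] [W.IsGloballyMinimal] [NeZero (W.conductorNorm ℤ)]
  {A : WeierstrassCurve ℚ} [A.IsElliptic] [A.IsGloballyMinimal] [NeZero (A.conductorNorm ℤ)]
  {f : CuspForm (Gamma0 (W.conductorNorm ℤ)) 2} {fA : CuspForm (Gamma0 (A.conductorNorm ℤ)) 2}

/-- **Analytic `μ`-propagation along a mod-`2` congruence for a congruent curve `A` of ANY analytic rank** — verbatim
`curveDepletedSymbolMax_of_congruent_of_plusLine` (`…CurveMuPropagation`, p612136) with `A.analyticRank = 0` replaced by Deligne's named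
fact (which only scales `A`'s depleted symbol primitively, §2): under (C3⁺), for `S₀ ⊇ bad(W) ∪ bad(A)`, (μ-W₁)(A, S₀) ⟹ (μ-W₁)(W, S₀).
[cite: GreenbergVatsal2000, Thm. (1.4) and §3 (shape)] [cite: Deligne1974, Thm. (8.2)] -/
theorem curveDepletedSymbolMax_of_congruent_of_plusLine_of_deligne
    (hC3 : ∀ (W : WeierstrassCurve ℚ) [W.IsElliptic] [W.IsGloballyMinimal], Literature.NumberTheory.EllipticCurves.Rank1Residual.GoodSS W 2 → W.Δ < 0 → ∀ (N' : ℕ), Odd N' → ∀ {N : ℕ} [NeZero N] (f : CuspForm (CongruenceSubgroup.Gamma0 N) 2), Literature.NumberTheory.EllipticCurves.ModularForms.IsNewformOf W f → ∀ (S : Finset ℕ), (∀ ℓ ∈ S, ℓ.Prime) → S.Nonempty → N * ∏ ℓ ∈ S, ℓ ^ 2 ∣ N' → (∀ p : ℕ, p.Prime → p ∣ N' → p ∈ S) → (∀ v : IsDedekindDomain.HeightOneSpectrum (NumberField.RingOfIntegers ℚ), ¬ ((Rat.HeightOneSpectrum.primesEquiv v : ℕ) ∣ 2 * N') → W.HasGoodReductionAt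 v) → ∀ (Φ₁ Φ₂ : ℚ → PadicAlgCl 2), (∀ (r : ℚ) (z : ℤ), Φ₁ (r + z) = Φ₁ r) → (∀ r : ℚ, Φ₁ (-r) = Φ₁ r) → (∀ (γ : CongruenceSubgroup.Gamma0 (N')) (r : ℚ), ((γ : SL(2, ℤ)) 1 0 : ℚ) * r + ((γ : SL(2, ℤ)) 1 1 : ℚ) ≠ 0 → Φ₁ ((((γ : SL(2, ℤ)) 0 0 : ℚ) * r + ((γ : SL(2, ℤ)) 0 1 : ℚ)) / (((γ : SL(2, ℤ)) 1 0 : ℚ) * r + ((γ : SL(2, ℤ)) 1 1 : ℚ))) = (if ((γ : SL(2, ℤ)) 1 0) = 0 then 0 else Φ₁ ((((γ : SL(2, ℤ)) 0 0 : ℚ)) / (((γ : SL(2, ℤ)) 1 0 : ℚ)))) + Φ₁ r) → (∀ (r : ℚ) (z : ℤ), Φ₂ (r + z) = Φ₂ r) → (∀ r : ℚ, Φ₂ (-r) = Φ₂ r) → (∀ (γ : CongruenceSubgroup.Gamma0 (N')) (r : ℚ), ((γ : SL(2, ℤ)) 1 0 : ℚ) * r + ((γ : SL(2, ℤ)) 1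 1 : ℚ) ≠ 0 → Φ₂ ((((γ : SL(2, ℤ)) 0 0 : ℚ) * r + ((γ : SL(2, ℤ)) 0 1 : ℚ)) / (((γ : SL(2, ℤ)) 1 0 : ℚ) * r + ((γ : SL(2, ℤ)) 1 1 : ℚ))) = (if ((γ : SL(2, ℤ)) 1 0) = 0 then 0 else Φ₂ ((((γ : SL(2, ℤ)) 0 0 : ℚ)) / (((γ : SL(2, ℤ)) 1 0 : ℚ)))) + Φ₂ r) → (∀ r : ℚ, ‖Φ₁ r‖ ≤ 1) → (∀ r : ℚ, ‖Φ₂ r‖ ≤ 1) → (∃ r : ℚ, ‖Φ₁ r‖ = 1) → (∃ r : ℚ, ‖Φ₂ r‖ = 1) → (∀ q : ℕ, q.Prime → ¬ q ∣ N' → ∀ r : ℚ, ‖(∑ j : Fin q, Φ₁ ((r + j) / q)) + Φ₁ (q * r) - (W.LFunction q : PadicAlgCl 2) * Φ₁ r‖ < 1) → (∀ q : ℕ, q.Prime → ¬ q ∣ N' → ∀ r : ℚ, ‖(∑ j : Fin q, Φ₂ ((r + j) / q)) + Φ₂ (q * r) - (W.LFunction q : PadicAlgCl 2) * Φ₂ r‖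 < 1) → (∀ ℓ : ℕ, ℓ.Prime → ℓ ∣ N' → ∀ r : ℚ, ‖∑ j : Fin ℓ, Φ₁ ((r + j) / ℓ)‖ < 1) → (∀ ℓ : ℕ, ℓ.Prime → ℓ ∣ N' → ∀ r : ℚ, ‖∑ j : Fin ℓ, Φ₂ ((r + j) / ℓ)‖ < 1) → ∃ a : PadicAlgCl 2, ∀ r : ℚ, ‖a * Φ₁ r - Φ₂ r‖ < 1)
    (hss : Literature.NumberTheory.EllipticCurves.Rank1Residual.GoodSS W 2) (hΔ : W.Δ < 0) (hf : IsNewformOf W f)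
    (hr : W.analyticRank = 0) (hAodd : Odd (A.conductorNorm ℤ)) (hfA : IsNewformOf A fA)
    (hD : Deligne1974_heckeT_eigenvalue_norm_le)
    (hcong : ∀ q : ℕ, q.Prime → ¬ q ∣ W.conductorNorm ℤ → ¬ q ∣ A.conductorNorm ℤ →
      ‖(A.LFunction q : PadicAlgCl 2) - (W.LFunction q : PadicAlgCl 2)‖ < 1)
    (S₀ : Finset (IsDedekindDomain.HeightOneSpectrum (NumberField.RingOfIntegers ℚ)))
    (hS2 : ∀ v ∈ S₀, ((2 : ℕ) : NumberField.RingOfIntegers ℚ) ∉ v.asIdeal)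
    (hSW : ∀ v : IsDedekindDomain.HeightOneSpectrum (NumberField.RingOfIntegers ℚ), ¬ W.HasGoodReductionAt v → v ∈ S₀)
    (hSA : ∀ v : IsDedekindDomain.HeightOneSpectrum (NumberField.RingOfIntegers ℚ), ¬ A.HasGoodReductionAt v → v ∈ S₀)
    (hμA : ∃ n₁ : ℕ, Even n₁ ∧ ∃ s : ZMod (2 ^ n₁), ∀ r : ℚ, ‖(∑ k ∈ Fintype.piFinset (fun _ : S₀ ↦ Finset.range 3), (∏ v : S₀, ((A.localPolynomialAt (v : IsDedekindDomain.HeightOneSpectrum (NumberField.RingOfIntegers ℚ))).map (Int.castRingHom (PadicAlgCl 2))).coeff (k v) * ((Rat.HeightOneSpectrum.natGenerator (v : IsDedekindDomain.HeightOneSpectrum (NumberField.RingOfIntegers ℚ)) : PadicAlgCl 2)⁻¹) ^ (k v)) * algebraMap ℚ (PadicAlgCl 2) (ratPlusSymbol fA (r * ((∏ v : S₀, Rat.HeightOneSpectrum.natGenerator (v : IsDedekindDomain.HeightOneSpectrum (NumberField.RingOfIntegers ℚ)) ^ (k v) : ℕ) : ℚ))))‖ ≤ ‖(∑ k ∈ Fintype.piFinset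 (fun _ : S₀ ↦ Finset.range 3), (∏ v : S₀, ((A.localPolynomialAt (v : IsDedekindDomain.HeightOneSpectrum (NumberField.RingOfIntegers ℚ))).map (Int.castRingHom (PadicAlgCl 2))).coeff (k v) * ((Rat.HeightOneSpectrum.natGenerator (v : IsDedekindDomain.HeightOneSpectrum (NumberField.RingOfIntegers ℚ)) : PadicAlgCl 2)⁻¹) ^ (k v)) * algebraMap ℚ (PadicAlgCl 2) (ratPlusSymbol fA ((((((Literature.NumberTheory.EllipticCurves.cyclotomicGenerator 2 : ZMod (2 ^ (n₁ + 2))) ^ s.val).val : ℚ) / (2 : ℚ) ^ (n₁ + 2))) * ((∏ v : S₀, Rat.HeightOneSpectrum.natGenerator (v : IsDedekindDomain.HeightOneSpectrum (NumberField.RingOfIntegers ℚ)) ^ (k v) : ℕ) : ℚ))))‖) :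
    ∃ n₁ : ℕ, Even n₁ ∧ ∃ s : ZMod (2 ^ n₁), ∀ r : ℚ, ‖(∑ k ∈ Fintype.piFinset (fun _ : S₀ ↦ Finset.range 3), (∏ v : S₀, ((W.localPolynomialAt (v : IsDedekindDomain.HeightOneSpectrum (NumberField.RingOfIntegers ℚ))).map (Int.castRingHom (PadicAlgCl 2))).coeff (k v) * ((Rat.HeightOneSpectrum.natGenerator (v : IsDedekindDomain.HeightOneSpectrum (NumberField.RingOfIntegers ℚ)) : PadicAlgCl 2)⁻¹) ^ (k v)) * algebraMap ℚ (PadicAlgCl 2) (ratPlusSymbol f (r * ((∏ v : S₀, Rat.HeightOneSpectrum.natGenerator (v : IsDedekindDomain.HeightOneSpectrum (NumberField.RingOfIntegers ℚ)) ^ (k v) : ℕ) : ℚ))))‖ ≤ ‖(∑ k ∈ Fintype.piFinset (fun _ : S₀ ↦ Finset.range 3), (∏ v : S₀, ((W.localPolynomialAt (v : IsDedekindDomain.HeightOneSpectrum (NumberField.RingOfIntegers ℚ))).map (Int.castRingHom (PadicAlgCl 2))).coeff (k v) * ((Rat.HeightOneSpectrum.natGenerator (v : IsDedekindDomain.HeightOneSpectrum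 (NumberField.RingOfIntegers ℚ)) : PadicAlgCl 2)⁻¹) ^ (k v)) * algebraMap ℚ (PadicAlgCl 2) (ratPlusSymbol f ((((((Literature.NumberTheory.EllipticCurves.cyclotomicGenerator 2 : ZMod (2 ^ (n₁ + 2))) ^ s.val).val : ℚ) / (2 : ℚ) ^ (n₁ + 2))) * ((∏ v : S₀, Rat.HeightOneSpectrum.natGenerator (v : IsDedekindDomain.HeightOneSpectrum (NumberField.RingOfIntegers ℚ)) ^ (k v) : ℕ) : ℚ))))‖ := by
  classical
  have hSMA : ∀ v : IsDedekindDomain.HeightOneSpectrum (NumberField.RingOfIntegers ℚ),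
      Rat.HeightOneSpectrum.natGenerator v ∣ A.conductorNorm ℤ → v ∈ S₀ :=
    fun v hv ↦ mem_of_natGenerator_dvd_conductorNorm hSA v hv
  have hSMW : ∀ v : IsDedekindDomain.HeightOneSpectrum (NumberField.RingOfIntegers ℚ),
      Rat.HeightOneSpectrum.natGenerator v ∣ W.conductorNorm ℤ → v ∈ S₀ :=
    fun v hv ↦ mem_of_natGenerator_dvd_conductorNorm hSW v hv
  -- primitive scalings of the two depleted symbols (w2)
  obtain ⟨c, hcint, x, hx⟩ := exists_primitive_scaling_depletedCurveSymbol hf hr S₀ hS2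
  obtain ⟨y, hyint, xA, hxA⟩ := exists_primitive_scaling_depletedCurveSymbol_of_deligne hD hfA S₀
  -- the common depleted level `N' = N_W · N_A · ∏ ℓ_v²` and the level data of (C3⁺)
  have hN'odd := odd_depletedLevel W hss hAodd S₀ hS2
  obtain ⟨SS, hSSdef⟩ : ∃ SS : Finset ℕ, SS = S₀.image (fun v ↦ Rat.HeightOneSpectrum.natGenerator v) := ⟨_, rfl⟩
  have hSS : ∀ ℓ ∈ SS, ℓ.Prime := by
    intro ℓ hℓ
    rw [hSSdef] at hℓ
    obtain ⟨v, -, rfl⟩ := Finset.mem_image.mp hℓ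
    exact Rat.HeightOneSpectrum.prime_natGenerator v
  have hLS : ∀ p : ℕ, p.Prime → p ∣ W.conductorNorm ℤ * A.conductorNorm ℤ * (∏ v : S₀, Rat.HeightOneSpectrum.natGenerator (v : IsDedekindDomain.HeightOneSpectrum (NumberField.RingOfIntegers ℚ)) ^ 2) → p ∈ SS := by
    intro p hp hdvd
    obtain ⟨v₀, hv₀, hv₀p⟩ := exists_mem_natGenerator_eq_of_dvd W S₀ hSW hSMA hp hdvd
    rw [hSSdef]
    exact Finset.mem_image.mpr ⟨v₀, hv₀, hv₀p⟩
  have hSSne : SS.Nonempty := by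
    have h1 : W.conductorNorm ℤ * A.conductorNorm ℤ * (∏ v : S₀, Rat.HeightOneSpectrum.natGenerator (v : IsDedekindDomain.HeightOneSpectrum (NumberField.RingOfIntegers ℚ)) ^ 2) ≠ 1 := by
      intro h
      exact WeierstrassCurve.conductorNorm_ne_one W (Nat.eq_one_of_mul_eq_one_right (Nat.eq_one_of_mul_eq_one_right h))
    obtain ⟨p, hp, hpd⟩ := Nat.exists_prime_and_dvd h1
    exact ⟨p, hLS p hp hpd⟩
  have hNL : W.conductorNorm ℤ * ∏ ℓ ∈ SS, ℓ ^ 2 ∣ W.conductorNorm ℤ * A.conductorNorm ℤ * (∏ v : S₀, Rat.HeightOneSpectrum.natGenerator (v : IsDedekindDomain.HeightOneSpectrum (NumberField.RingOfIntegers ℚ)) ^ 2) := by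
    have hinj : Set.InjOn (fun v : IsDedekindDomain.HeightOneSpectrum (NumberField.RingOfIntegers ℚ) ↦ Rat.HeightOneSpectrum.natGenerator v) S₀ :=
      fun v _ w _ h ↦ Rat.HeightOneSpectrum.primesEquiv.injective (Subtype.ext h)
    rw [hSSdef, Finset.prod_image hinj, ← Finset.prod_coe_sort S₀]
    exact ⟨A.conductorNorm ℤ, by ring⟩
  have hgoodL : ∀ v : IsDedekindDomain.HeightOneSpectrum (NumberField.RingOfIntegers ℚ), ¬ ((Rat.HeightOneSpectrum.primesEquiv v : ℕ) ∣ 2 * (W.conductorNorm ℤ * A.conductorNorm ℤ * (∏ v : S₀, Rat.HeightOneSpectrum.natGenerator (v : IsDedekindDomain.HeightOneSpectrum (NumberField.RingOfIntegers ℚ)) ^ 2))) → W.HasGoodReductionAt v := by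
    intro v hv
    by_contra hbad
    apply hv
    have h1 : Rat.HeightOneSpectrum.natGenerator v ∣ ∏ w ∈ S₀, Rat.HeightOneSpectrum.natGenerator w ^ 2 :=
      (dvd_pow_self _ two_ne_zero).trans
        (Finset.dvd_prod_of_mem (fun w ↦ Rat.HeightOneSpectrum.natGenerator w ^ 2) (hSW v hbad))
    rw [Finset.prod_coe_sort S₀ (fun w ↦ Rat.HeightOneSpectrum.natGenerator w ^ 2)]
    exact Dvd.dvd.mul_left (Dvd.dvd.mul_left h1 _) 2
  have hdvdW : W.conductorNorm ℤ * (∏ v : S₀, Rat.HeightOneSpectrum.natGenerator (v : IsDedekindDomain.HeightOneSpectrum (NumberField.RingOfIntegers ℚ)) ^ 2) ∣ W.conductorNorm ℤ * A.conductorNorm ℤ * (∏ v : S₀, Rat.HeightOneSpectrum.natGenerator (v : IsDedekindDomain.HeightOneSpectrum (NumberField.RingOfIntegers ℚ)) ^ 2) := ⟨A.conductorNorm ℤ, by ring⟩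
  have hdvdA : A.conductorNorm ℤ * (∏ v : S₀, Rat.HeightOneSpectrum.natGenerator (v : IsDedekindDomain.HeightOneSpectrum (NumberField.RingOfIntegers ℚ)) ^ 2) ∣ W.conductorNorm ℤ * A.conductorNorm ℤ * (∏ v : S₀, Rat.HeightOneSpectrum.natGenerator (v : IsDedekindDomain.HeightOneSpectrum (NumberField.RingOfIntegers ℚ)) ^ 2) := ⟨W.conductorNorm ℤ, by ring⟩
  have hoff : ∀ q : ℕ, ¬ q ∣ W.conductorNorm ℤ * A.conductorNorm ℤ * (∏ v : S₀, Rat.HeightOneSpectrum.natGenerator (v : IsDedekindDomain.HeightOneSpectrum (NumberField.RingOfIntegers ℚ)) ^ 2) →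
      ¬ q ∣ W.conductorNorm ℤ ∧ ¬ q ∣ A.conductorNorm ℤ ∧ ∀ v ∈ S₀, Rat.HeightOneSpectrum.natGenerator v ≠ q :=
    fun q hnd ↦ off_depletedLevel W (A.conductorNorm ℤ) S₀ hnd
  have hdvd' : ∀ ℓ : ℕ, ℓ ∣ W.conductorNorm ℤ * A.conductorNorm ℤ * (∏ v : S₀, Rat.HeightOneSpectrum.natGenerator (v : IsDedekindDomain.HeightOneSpectrum (NumberField.RingOfIntegers ℚ)) ^ 2) → ℓ ∣ A.conductorNorm ℤ * W.conductorNorm ℤ * (∏ v : S₀, Rat.HeightOneSpectrum.natGenerator (v : IsDedekindDomain.HeightOneSpectrum (NumberField.RingOfIntegers ℚ)) ^ 2) := by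
    intro ℓ hd
    rwa [mul_comm (A.conductorNorm ℤ) (W.conductorNorm ℤ)]
  -- the plus line: `Φ_A ≡ a · Φ_W (mod 𝔪)`
  obtain ⟨a, ha'⟩ := hC3 W hss hΔ _ hN'odd f hf SS hSS hSSne hNL hLS hgoodL
    (fun x ↦ c * (∑ k ∈ Fintype.piFinset (fun _ : S₀ ↦ Finset.range 3), (∏ v : S₀, ((W.localPolynomialAt (v : IsDedekindDomain.HeightOneSpectrum (NumberField.RingOfIntegers ℚ))).map (Int.castRingHom (PadicAlgCl 2))).coeff (k v) * ((Rat.HeightOneSpectrum.natGenerator (v : IsDedekindDomain.HeightOneSpectrum (NumberField.RingOfIntegers ℚ)) : PadicAlgCl 2)⁻¹) ^ (k v)) * algebraMap ℚ (PadicAlgCl 2) (ratPlusSymbol f (x * ((∏ v : S₀, Rat.HeightOneSpectrum.natGenerator (v : IsDedekindDomain.HeightOneSpectrum (NumberField.RingOfIntegers ℚ)) ^ (k v) : ℕ) : ℚ))))) (fun x ↦ y * (∑ k ∈ Fintype.piFinset (fun _ : S₀ ↦ Finset.range 3), (∏ v : S₀, ((A.localPolynomialAt (v : IsDedekindDomain.HeightOneSpectrum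 (NumberField.RingOfIntegers ℚ))).map (Int.castRingHom (PadicAlgCl 2))).coeff (k v) * ((Rat.HeightOneSpectrum.natGenerator (v : IsDedekindDomain.HeightOneSpectrum (NumberField.RingOfIntegers ℚ)) : PadicAlgCl 2)⁻¹) ^ (k v)) * algebraMap ℚ (PadicAlgCl 2) (ratPlusSymbol fA (x * ((∏ v : S₀, Rat.HeightOneSpectrum.natGenerator (v : IsDedekindDomain.HeightOneSpectrum (NumberField.RingOfIntegers ℚ)) ^ (k v) : ℕ) : ℚ)))))
    (depletedCurveSymbol_add_intCast W S₀ c) (depletedCurveSymbol_neg W S₀ c)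
    (depletedCurveSymbol_gamma0_smul_of_dvd hf c hdvdW)
    (depletedCurveSymbol_add_intCast A S₀ y) (depletedCurveSymbol_neg A S₀ y)
    (depletedCurveSymbol_gamma0_smul_of_dvd hfA y hdvdA)
    hcint hyint ⟨x, hx⟩ ⟨xA, hxA⟩
    (fun q hq hnd r ↦ by
      rw [depletedCurveSymbol_heckeT_sub_eq_zero hf c hq (hoff q hnd).1 (hoff q hnd).2.2 r, norm_zero]
      exact zero_lt_one)
    (fun q hq hnd r ↦ by
      have e := depletedCurveSymbol_heckeT_sub_eq_zero hfA y hq (hoff q hnd).2.1 (hoff q hnd).2.2 r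
      rw [sub_eq_zero] at e
      rw [e, ← sub_mul, norm_mul]
      exact mul_lt_one_of_nonneg_of_lt_one_left (norm_nonneg _) (hcong q hq (hoff q hnd).1 (hoff q hnd).2.1) (hyint r))
    (fun ℓ hℓ hd r ↦ by
      rw [depletedCurveSymbol_heckeU_eq_zero hf c hSW hSMA hℓ hd r, norm_zero]; exact zero_lt_one)
    (fun ℓ hℓ hd r ↦ by
      rw [depletedCurveSymbol_heckeU_eq_zero hfA y hSA hSMW hℓ (hdvd' ℓ hd) r, norm_zero]; exact zero_lt_one)
  simp only at ha'
  -- `a` is a unit, so the unit loci coincide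
  have ha1 : ‖a‖ = 1 :=
    norm_eq_one_of_congr_of_primitive (Φ₁ := (fun x ↦ c * (∑ k ∈ Fintype.piFinset (fun _ : S₀ ↦ Finset.range 3), (∏ v : S₀, ((W.localPolynomialAt (v : IsDedekindDomain.HeightOneSpectrum (NumberField.RingOfIntegers ℚ))).map (Int.castRingHom (PadicAlgCl 2))).coeff (k v) * ((Rat.HeightOneSpectrum.natGenerator (v : IsDedekindDomain.HeightOneSpectrum (NumberField.RingOfIntegers ℚ)) : PadicAlgCl 2)⁻¹) ^ (k v)) * algebraMap ℚ (PadicAlgCl 2) (ratPlusSymbol f (x * ((∏ v : S₀, Rat.HeightOneSpectrum.natGenerator (v : IsDedekindDomain.HeightOneSpectrum (NumberField.RingOfIntegers ℚ)) ^ (k v) : ℕ) : ℚ)))))) (Φ₂ := (fun x ↦ y * (∑ k ∈ Fintype.piFinset (fun _ : S₀ ↦ Finset.range 3), (∏ v : S₀, ((A.localPolynomialAt (v : IsDedekindDomain.HeightOneSpectrum (NumberField.RingOfIntegers ℚ))).map (Int.castRingHom (PadicAlgCl 2))).coeff (k v) * ((Rat.HeightOneSpectrum.natGenerator (v : IsDedekindDomain.HeightOneSpectrum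 (NumberField.RingOfIntegers ℚ)) : PadicAlgCl 2)⁻¹) ^ (k v)) * algebraMap ℚ (PadicAlgCl 2) (ratPlusSymbol fA (x * ((∏ v : S₀, Rat.HeightOneSpectrum.natGenerator (v : IsDedekindDomain.HeightOneSpectrum (NumberField.RingOfIntegers ℚ)) ^ (k v) : ℕ) : ℚ)))))) hcint hyint ⟨x, hx⟩ ⟨xA, hxA⟩ ha'
  -- (μ-W₁)(A, S₀): the `A`-side is a unit at the even-layer cusp, hence so is the `W`-side
  obtain ⟨n₁, hn₁e, s₁, hmaxA⟩ := hμA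
  have hA1 : ‖y * (∑ k ∈ Fintype.piFinset (fun _ : S₀ ↦ Finset.range 3), (∏ v : S₀, ((A.localPolynomialAt (v : IsDedekindDomain.HeightOneSpectrum (NumberField.RingOfIntegers ℚ))).map (Int.castRingHom (PadicAlgCl 2))).coeff (k v) * ((Rat.HeightOneSpectrum.natGenerator (v : IsDedekindDomain.HeightOneSpectrum (NumberField.RingOfIntegers ℚ)) : PadicAlgCl 2)⁻¹) ^ (k v)) * algebraMap ℚ (PadicAlgCl 2) (ratPlusSymbol fA ((((((Literature.NumberTheory.EllipticCurves.cyclotomicGenerator 2 : ZMod (2 ^ (n₁ + 2))) ^ s₁.val).val : ℚ) / (2 : ℚ) ^ (n₁ + 2))) * ((∏ v : S₀, Rat.HeightOneSpectrum.natGenerator (v : IsDedekindDomain.HeightOneSpectrum (NumberField.RingOfIntegers ℚ)) ^ (k v) : ℕ) : ℚ))))‖ = 1 := by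
    refine le_antisymm (hyint _) ?_
    rw [← hxA, norm_mul, norm_mul]
    exact mul_le_mul_of_nonneg_left (hmaxA xA) (norm_nonneg y)
  have hW1 : ‖c * (∑ k ∈ Fintype.piFinset (fun _ : S₀ ↦ Finset.range 3), (∏ v : S₀, ((W.localPolynomialAt (v : IsDedekindDomain.HeightOneSpectrum (NumberField.RingOfIntegers ℚ))).map (Int.castRingHom (PadicAlgCl 2))).coeff (k v) * ((Rat.HeightOneSpectrum.natGenerator (v : IsDedekindDomain.HeightOneSpectrum (NumberField.RingOfIntegers ℚ)) : PadicAlgCl 2)⁻¹) ^ (k v)) * algebraMap ℚ (PadicAlgCl 2) (ratPlusSymbol f ((((((Literature.NumberTheory.EllipticCurves.cyclotomicGenerator 2 : ZMod (2 ^ (n₁ + 2))) ^ s₁.val).val : ℚ) / (2 : ℚ) ^ (n₁ + 2))) * ((∏ v : S₀, Rat.HeightOneSpectrum.natGenerator (v : IsDedekindDomain.HeightOneSpectrum (NumberField.RingOfIntegers ℚ)) ^ (k v) : ℕ) : ℚ))))‖ = 1 :=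
    (norm_eq_one_iff_of_unit_congr ha1 (hcint _) (hyint _) (ha' _)).mpr hA1
  -- unscale: `‖Φ_W(r)‖ ≤ ‖c‖⁻¹ = ‖Φ_W(cusp)‖`
  have hc0 : ‖c‖ ≠ 0 := by
    intro h0
    rw [norm_mul, h0, zero_mul] at hW1
    exact zero_ne_one hW1
  have hcpos : 0 < ‖c‖ := lt_of_le_of_ne (norm_nonneg c) (Ne.symm hc0)
  refine ⟨n₁, hn₁e, s₁, fun r ↦ ?_⟩
  have h1 := hcint r
  rw [norm_mul] at h1 hW1
  nlinarith [h1, hW1, hcpos, norm_nonneg ((∑ k ∈ Fintype.piFinset (fun _ : S₀ ↦ Finset.range 3), (∏ v : S₀, ((W.localPolynomialAt (v : IsDedekindDomain.HeightOneSpectrum (NumberField.RingOfIntegers ℚ))).map (Int.castRingHom (PadicAlgCl 2))).coeff (k v) * ((Rat.HeightOneSpectrum.natGenerator (v : IsDedekindDomain.HeightOneSpectrum (NumberField.RingOfIntegers ℚ)) : PadicAlgCl 2)⁻¹) ^ (k v)) * algebraMap ℚ (PadicAlgCl 2) (ratPlusSymbol f (r * ((∏ v : S₀, Rat.HeightOneSpectrum.natGenerator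 (v : IsDedekindDomain.HeightOneSpectrum (NumberField.RingOfIntegers ℚ)) ^ (k v) : ℕ) : ℚ))))), norm_nonneg ((∑ k ∈ Fintype.piFinset (fun _ : S₀ ↦ Finset.range 3), (∏ v : S₀, ((W.localPolynomialAt (v : IsDedekindDomain.HeightOneSpectrum (NumberField.RingOfIntegers ℚ))).map (Int.castRingHom (PadicAlgCl 2))).coeff (k v) * ((Rat.HeightOneSpectrum.natGenerator (v : IsDedekindDomain.HeightOneSpectrum (NumberField.RingOfIntegers ℚ)) : PadicAlgCl 2)⁻¹) ^ (k v)) * algebraMap ℚ (PadicAlgCl 2) (ratPlusSymbol f ((((((Literature.NumberTheory.EllipticCurves.cyclotomicGenerator 2 : ZMod (2 ^ (n₁ + 2))) ^ s₁.val).val : ℚ) / (2 : ℚ) ^ (n₁ + 2))) * ((∏ v : S₀, Rat.HeightOneSpectrum.natGenerator (v : IsDedekindDomain.HeightOneSpectrum (NumberField.RingOfIntegers ℚ)) ^ (k v) : ℕ) : ℚ)))))]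

/-- **Propagation from the six plus-line facts + Deligne, congruent `A` of any rank**: (μ-W₁)(A,S₀) ⟹ (μ-W₁)(W,S₀) for
`S₀ ⊇ bad(W) ∪ bad(A)`. [cite: GreenbergVatsal2000, Thm. (1.4) (shape)] [cite: Buzzard2000LevelLoweringModTwo, Prop. 2.4] -/
theorem curveDepletedSymbolMax_of_congruent_of_deligne
    (hES : eichlerShimura_depletedOptimalQuotient_periodLattice_of_dvd)
    (hF : WeierstrassCurve.isIsogenous_iff_frobeniusTrace_eq) (hMK : mazurKenku_exists_cyclic_isogeny)
    (hSD : heckeSelfDual_torsionBy_J0) (hBz : buzzard2000_multiplicityOne_gamma0)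
    (hSe : serre1972_supersingular_decompositionSubgroup_image) (hD : Deligne1974_heckeT_eigenvalue_norm_le)
    (hss : Literature.NumberTheory.EllipticCurves.Rank1Residual.GoodSS W 2) (hΔ : W.Δ < 0) (hf : IsNewformOf W f)
    (hr : W.analyticRank = 0) (hAodd : Odd (A.conductorNorm ℤ)) (hfA : IsNewformOf A fA)
    (hcong : ∀ q : ℕ, q.Prime → ¬ q ∣ W.conductorNorm ℤ → ¬ q ∣ A.conductorNorm ℤ →
      ‖(A.LFunction q : PadicAlgCl 2) - (W.LFunction q : PadicAlgCl 2)‖ < 1)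
    (S₀ : Finset (IsDedekindDomain.HeightOneSpectrum (NumberField.RingOfIntegers ℚ)))
    (hS2 : ∀ v ∈ S₀, ((2 : ℕ) : NumberField.RingOfIntegers ℚ) ∉ v.asIdeal)
    (hSW : ∀ v : IsDedekindDomain.HeightOneSpectrum (NumberField.RingOfIntegers ℚ), ¬ W.HasGoodReductionAt v → v ∈ S₀)
    (hSA : ∀ v : IsDedekindDomain.HeightOneSpectrum (NumberField.RingOfIntegers ℚ), ¬ A.HasGoodReductionAt v → v ∈ S₀)
    (hμA : ∃ n₁ : ℕ, Even n₁ ∧ ∃ s : ZMod (2 ^ n₁), ∀ r : ℚ, ‖(∑ k ∈ Fintype.piFinset (fun _ : S₀ ↦ Finset.range 3), (∏ v : S₀, ((A.localPolynomialAt (v : IsDedekindDomain.HeightOneSpectrum (NumberField.RingOfIntegers ℚ))).map (Int.castRingHom (PadicAlgCl 2))).coeff (k v) * ((Rat.HeightOneSpectrum.natGenerator (v : IsDedekindDomain.HeightOneSpectrum (NumberField.RingOfIntegers ℚ)) : PadicAlgCl 2)⁻¹) ^ (k v)) * algebraMap ℚ (PadicAlgCl 2) (ratPlusSymbol fA (r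 * ((∏ v : S₀, Rat.HeightOneSpectrum.natGenerator (v : IsDedekindDomain.HeightOneSpectrum (NumberField.RingOfIntegers ℚ)) ^ (k v) : ℕ) : ℚ))))‖ ≤ ‖(∑ k ∈ Fintype.piFinset (fun _ : S₀ ↦ Finset.range 3), (∏ v : S₀, ((A.localPolynomialAt (v : IsDedekindDomain.HeightOneSpectrum (NumberField.RingOfIntegers ℚ))).map (Int.castRingHom (PadicAlgCl 2))).coeff (k v) * ((Rat.HeightOneSpectrum.natGenerator (v : IsDedekindDomain.HeightOneSpectrum (NumberField.RingOfIntegers ℚ)) : PadicAlgCl 2)⁻¹) ^ (k v)) * algebraMap ℚ (PadicAlgCl 2) (ratPlusSymbol fA ((((((Literature.NumberTheory.EllipticCurves.cyclotomicGenerator 2 : ZMod (2 ^ (n₁ + 2))) ^ s.val).val : ℚ) / (2 : ℚ) ^ (n₁ + 2))) * ((∏ v : S₀, Rat.HeightOneSpectrum.natGenerator (v : IsDedekindDomain.HeightOneSpectrum (NumberField.RingOfIntegers ℚ)) ^ (k v) : ℕ) : ℚ))))‖) :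
    ∃ n₁ : ℕ, Even n₁ ∧ ∃ s : ZMod (2 ^ n₁), ∀ r : ℚ, ‖(∑ k ∈ Fintype.piFinset (fun _ : S₀ ↦ Finset.range 3), (∏ v : S₀, ((W.localPolynomialAt (v : IsDedekindDomain.HeightOneSpectrum (NumberField.RingOfIntegers ℚ))).map (Int.castRingHom (PadicAlgCl 2))).coeff (k v) * ((Rat.HeightOneSpectrum.natGenerator (v : IsDedekindDomain.HeightOneSpectrum (NumberField.RingOfIntegers ℚ)) : PadicAlgCl 2)⁻¹) ^ (k v)) * algebraMap ℚ (PadicAlgCl 2) (ratPlusSymbol f (r * ((∏ v : S₀, Rat.HeightOneSpectrum.natGenerator (v : IsDedekindDomain.HeightOneSpectrum (NumberField.RingOfIntegers ℚ)) ^ (k v) : ℕ) : ℚ))))‖ ≤ ‖(∑ k ∈ Fintype.piFinset (fun _ : S₀ ↦ Finset.range 3), (∏ v : S₀, ((W.localPolynomialAt (v : IsDedekindDomain.HeightOneSpectrum (NumberField.RingOfIntegers ℚ))).map (Int.castRingHom (PadicAlgCl 2))).coeff (k v) * ((Rat.HeightOneSpectrum.natGenerator (v : IsDedekindDomain.HeightOneSpectrum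 (NumberField.RingOfIntegers ℚ)) : PadicAlgCl 2)⁻¹) ^ (k v)) * algebraMap ℚ (PadicAlgCl 2) (ratPlusSymbol f ((((((Literature.NumberTheory.EllipticCurves.cyclotomicGenerator 2 : ZMod (2 ^ (n₁ + 2))) ^ s.val).val : ℚ) / (2 : ℚ) ^ (n₁ + 2))) * ((∏ v : S₀, Rat.HeightOneSpectrum.natGenerator (v : IsDedekindDomain.HeightOneSpectrum (NumberField.RingOfIntegers ℚ)) ^ (k v) : ℕ) : ℚ))))‖ :=
  curveDepletedSymbolMax_of_congruent_of_plusLine_of_deligne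
    (plusLineAtTwoLevel_of_charTwoLevel (plusLineCharTwo_of_facts hES hF hMK hSD hBz hSe))
    hss hΔ hf hr hAodd hfA hD hcong S₀ hS2 hSW hSA hμA

/-- **(μ-W₀)(A) for a `2`-congruent curve `A` of ANY analytic rank ⟹ (μ-W₁)(W, S₀) for every admissible `S₀ ⊇ bad(W) ∪ bad(A)`**
(six plus-line facts + Deligne; `A` good at `2` with `a₂(A) = 0`): lead g7's `curveDepletedSymbolMax_of_plusSymbolMax` then §3.
[cite: GreenbergVatsal2000, Thm. (1.4) (shape)] [cite: PollackWeston2011MT, Rem. 4.2] -/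
theorem curveDepletedSymbolMax_of_congruent_of_plusSymbolMax_of_deligne
    (hES : eichlerShimura_depletedOptimalQuotient_periodLattice_of_dvd)
    (hF : WeierstrassCurve.isIsogenous_iff_frobeniusTrace_eq) (hMK : mazurKenku_exists_cyclic_isogeny)
    (hSD : heckeSelfDual_torsionBy_J0) (hBz : buzzard2000_multiplicityOne_gamma0)
    (hSe : serre1972_supersingular_decompositionSubgroup_image) (hD : Deligne1974_heckeT_eigenvalue_norm_le)
    (hss : Literature.NumberTheory.EllipticCurves.Rank1Residual.GoodSS W 2) (hΔ : W.Δ < 0) (hf : IsNewformOf W f)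
    (hr : W.analyticRank = 0) (hssA : Literature.NumberTheory.EllipticCurves.Rank1Residual.GoodSS A 2)
    (haA : A.frobeniusTrace 2 = 0) (hfA : IsNewformOf A fA)
    (hcong : ∀ q : ℕ, q.Prime → ¬ q ∣ W.conductorNorm ℤ → ¬ q ∣ A.conductorNorm ℤ →
      ‖(A.LFunction q : PadicAlgCl 2) - (W.LFunction q : PadicAlgCl 2)‖ < 1)
    (hμ0A : ∃ n₁ : ℕ, Even n₁ ∧ ∃ s : ZMod (2 ^ n₁), ∀ r : ℚ, ‖algebraMap ℚ (PadicAlgCl 2) (ratPlusSymbol fA (r))‖ ≤ ‖algebraMap ℚ (PadicAlgCl 2) (ratPlusSymbol fA (((((cyclotomicGenerator 2 : ZMod (2 ^ ((n₁) + 2))) ^ (s).val).val : ℚ) / (2 : ℚ) ^ ((n₁) + 2))))‖)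
    (S₀ : Finset (IsDedekindDomain.HeightOneSpectrum (NumberField.RingOfIntegers ℚ)))
    (hS2 : ∀ v ∈ S₀, ((2 : ℕ) : NumberField.RingOfIntegers ℚ) ∉ v.asIdeal)
    (hSW : ∀ v : IsDedekindDomain.HeightOneSpectrum (NumberField.RingOfIntegers ℚ), ¬ W.HasGoodReductionAt v → v ∈ S₀)
    (hSA : ∀ v : IsDedekindDomain.HeightOneSpectrum (NumberField.RingOfIntegers ℚ), ¬ A.HasGoodReductionAt v → v ∈ S₀) :
    ∃ n₁ : ℕ, Even n₁ ∧ ∃ s : ZMod (2 ^ n₁), ∀ r : ℚ, ‖(∑ k ∈ Fintype.piFinset (fun _ : S₀ ↦ Finset.range 3), (∏ v : S₀, ((W.localPolynomialAt (v : IsDedekindDomain.HeightOneSpectrum (NumberField.RingOfIntegers ℚ))).map (Int.castRingHom (PadicAlgCl 2))).coeff (k v) * ((Rat.HeightOneSpectrum.natGenerator (v : IsDedekindDomain.HeightOneSpectrum (NumberField.RingOfIntegers ℚ)) : PadicAlgCl 2)⁻¹) ^ (k v)) * algebraMap ℚ (PadicAlgCl 2) (ratPlusSymbol f (r * ((∏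 v : S₀, Rat.HeightOneSpectrum.natGenerator (v : IsDedekindDomain.HeightOneSpectrum (NumberField.RingOfIntegers ℚ)) ^ (k v) : ℕ) : ℚ))))‖ ≤ ‖(∑ k ∈ Fintype.piFinset (fun _ : S₀ ↦ Finset.range 3), (∏ v : S₀, ((W.localPolynomialAt (v : IsDedekindDomain.HeightOneSpectrum (NumberField.RingOfIntegers ℚ))).map (Int.castRingHom (PadicAlgCl 2))).coeff (k v) * ((Rat.HeightOneSpectrum.natGenerator (v : IsDedekindDomain.HeightOneSpectrum (NumberField.RingOfIntegers ℚ)) : PadicAlgCl 2)⁻¹) ^ (k v)) * algebraMap ℚ (PadicAlgCl 2) (ratPlusSymbol f ((((((Literature.NumberTheory.EllipticCurves.cyclotomicGenerator 2 : ZMod (2 ^ (n₁ + 2))) ^ s.val).val : ℚ) / (2 : ℚ) ^ (n₁ + 2))) * ((∏ v : S₀, Rat.HeightOneSpectrum.natGenerator (v : IsDedekindDomain.HeightOneSpectrum (NumberField.RingOfIntegers ℚ)) ^ (k v) : ℕ) : ℚ))))‖ := by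
  have h2A : ¬ 2 ∣ A.conductorNorm ℤ := by
    rw [A.dvd_conductorNorm_iff_not_hasGoodReductionAtPrime 2, not_not]
    exact hssA.1
  exact curveDepletedSymbolMax_of_congruent_of_deligne hES hF hMK hSD hBz hSe hD hss hΔ hf hr
    (Nat.odd_iff.mpr (Nat.two_dvd_ne_zero.mp h2A)) hfA hcong
    S₀ hS2 hSW hSA (curveDepletedSymbolMax_of_plusSymbolMax hssA haA hfA hμ0A S₀ hS2)

end Propagation

end Summit.BirchSwinnertonDyer.BirchSwinnertonDyer.Theorems.ThetaLayerLambdaCongruenceAtTwo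

end
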